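import Summits.Ventures.PercRepro.C041TriDomExcessStatus

/-!
# ROW C-041 — THE EXCESS IS NON-NEGATIVE, II: THE RECURSION and the induction on the free edges
(p6, gen 41; P6-TWOEXIT-LEAN.md §53)

On the framework of `C041TriDomExcessStatus`: changing the status of ONE free edge `f`.  Colouring `f` red gives the
red pattern of the contraction (`f` double) and the blue pattern of the deletion (`f` absent); colouring it blue the
other way round (`rsig_of_true`, `rsig_of_false`, `bsig_of_true`, `bsig_of_false`); a non-free edge ignores its
colour (`rsig_update_nonfree`, `bsig_update_nonfree`); contracting only coarsens (`le3_rsig`, `le3_bsig`, by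
`reach_mono`).  The symmetrised excess `esym st = Σ_ω Fsym (rsig st ω) (bsig st ω)` over ALL colourings `ω : E₁ → Bool`
satisfies **THE RECURSION** (`esym_rec`): for a free edge `f`,
  `2 • esym st = esym (st[f := absent]) + esym (st[f := double]) + Σ_ω gap st f ω`,
where the two colours of `f` are exchanged by the flip involution `flipPerm f` (`summand_add_flip`) and the pointwise
gap is non-negative by THE KEY LEMMA (`gap_nonneg`).  Induction on the number of free edges `nfree` (no free edge:
red = blue, `Fsym` vanishes on the diagonal, `esym_of_nofree`) gives **`esym_nonneg : 0 ≤ esym st`** for every status.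
-/

namespace PercRepro

namespace ZoneZ

namespace MultiExit

open ZoneData Pendant Finset TwoExit TreeClosure RelaxedTriangle

variable {V₁ E₁ U₁ U₂ : Type} (Z₁ : ZoneData V₁ E₁ U₁ U₂) (u u' a₁ : V₁)

/-! ## Changing the status of one edge -/

variable [DecidableEq E₁]


/-- Colouring a free edge red: the red pattern is that of the contraction. -/
theorem rsig_of_true {st : E₁ → EStat} {f : E₁} (hf : st f = .free) {ω : E₁ → Bool} (hω : ω f = true) :
    rsig Z₁ u u' a₁ st ω = rsig Z₁ u u' a₁ (Function.update st f .double) ω := by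
  have h : RAdjS Z₁ st ω = RAdjS Z₁ (Function.update st f .double) ω := by
    refine RAdjS_congr Z₁ fun e => ?_
    by_cases he : e = f
    · subst he; simp [redE, hf, hω]
    · simp [redE, Function.update_of_ne he]
  exact rsig_congr Z₁ u u' a₁ h

/-- Colouring a free edge blue: the red pattern is that of the deletion. -/
theorem rsig_of_false {st : E₁ → EStat} {f : E₁} (hf : st f = .free) {ω : E₁ → Bool} (hω : ω f = false) :
    rsig Z₁ u u' a₁ st ω = rsig Z₁ u u' a₁ (Function.update st f .absent) ω := by
  have h : RAdjS Z₁ st ω = RAdjS Z₁ (Function.update st f .absent) ω := by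
    refine RAdjS_congr Z₁ fun e => ?_
    by_cases he : e = f
    · subst he; simp [redE, hf, hω]
    · simp [redE, Function.update_of_ne he]
  exact rsig_congr Z₁ u u' a₁ h

/-- Colouring a free edge red: the blue pattern is that of the deletion. -/
theorem bsig_of_true {st : E₁ → EStat} {f : E₁} (hf : st f = .free) {ω : E₁ → Bool} (hω : ω f = true) :
    bsig Z₁ u u' a₁ st ω = bsig Z₁ u u' a₁ (Function.update st f .absent) ω := by
  have h : BAdjS Z₁ st ω = BAdjS Z₁ (Function.update st f .absent) ω := by
    refine BAdjS_congr Z₁ fun e => ?_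
    by_cases he : e = f
    · subst he; simp [blueE, hf, hω]
    · simp [blueE, Function.update_of_ne he]
  exact bsig_congr Z₁ u u' a₁ h

/-- Colouring a free edge blue: the blue pattern is that of the contraction. -/
theorem bsig_of_false {st : E₁ → EStat} {f : E₁} (hf : st f = .free) {ω : E₁ → Bool} (hω : ω f = false) :
    bsig Z₁ u u' a₁ st ω = bsig Z₁ u u' a₁ (Function.update st f .double) ω := by
  have h : BAdjS Z₁ st ω = BAdjS Z₁ (Function.update st f .double) ω := by
    refine BAdjS_congr Z₁ fun e => ?_
    by_cases he : e = f
    · subst he; simp [blueE, hf, hω]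
    · simp [blueE, Function.update_of_ne he]
  exact bsig_congr Z₁ u u' a₁ h

/-- A non-free edge ignores its colour (red pattern). -/
theorem rsig_update_nonfree (st : E₁ → EStat) (f : E₁) {s : EStat} (hs : s ≠ .free) (ω : E₁ → Bool) (b : Bool) :
    rsig Z₁ u u' a₁ (Function.update st f s) (Function.update ω f b) = rsig Z₁ u u' a₁ (Function.update st f s) ω := by
  have h : RAdjS Z₁ (Function.update st f s) (Function.update ω f b) = RAdjS Z₁ (Function.update st f s) ω := by
    refine RAdjS_congr Z₁ fun e => ?_
    by_cases he : e = f
    · subst he; simp [redE, hs]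
    · simp [redE, Function.update_of_ne he]
  exact rsig_congr Z₁ u u' a₁ h

/-- A non-free edge ignores its colour (blue pattern). -/
theorem bsig_update_nonfree (st : E₁ → EStat) (f : E₁) {s : EStat} (hs : s ≠ .free) (ω : E₁ → Bool) (b : Bool) :
    bsig Z₁ u u' a₁ (Function.update st f s) (Function.update ω f b) = bsig Z₁ u u' a₁ (Function.update st f s) ω := by
  have h : BAdjS Z₁ (Function.update st f s) (Function.update ω f b) = BAdjS Z₁ (Function.update st f s) ω := by
    refine BAdjS_congr Z₁ fun e => ?_
    by_cases he : e = f
    · subst he; simp [blueE, hs]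
    · simp [blueE, Function.update_of_ne he]
  exact bsig_congr Z₁ u u' a₁ h

/-- Contracting an edge only coarsens the red pattern of its deletion. -/
theorem le3_rsig (st : E₁ → EStat) (f : E₁) (ω : E₁ → Bool) :
    Le3 (rsig Z₁ u u' a₁ (Function.update st f .absent) ω) (rsig Z₁ u u' a₁ (Function.update st f .double) ω) := by
  have h : ∀ x y, RAdjS Z₁ (Function.update st f .absent) ω x y → RAdjS Z₁ (Function.update st f .double) ω x y := by
    intro x y ⟨e, he, hr⟩
    refine ⟨e, he, ?_⟩
    by_cases hef : e = f
    · subst hef; simp [redE]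
    · simpa [redE, Function.update_of_ne hef] using hr
  simp only [Le3, rsig, RdS, decide_eq_true_eq]
  exact ⟨reach_mono h, reach_mono h, reach_mono h⟩

/-- Contracting an edge only coarsens the blue pattern of its deletion. -/
theorem le3_bsig (st : E₁ → EStat) (f : E₁) (ω : E₁ → Bool) :
    Le3 (bsig Z₁ u u' a₁ (Function.update st f .absent) ω) (bsig Z₁ u u' a₁ (Function.update st f .double) ω) := by
  have h : ∀ x y, BAdjS Z₁ (Function.update st f .absent) ω x y → BAdjS Z₁ (Function.update st f .double) ω x y := by
    intro x y ⟨e, he, hb⟩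
    refine ⟨e, he, ?_⟩
    by_cases hef : e = f
    · subst hef; simp [blueE]
    · simpa [blueE, Function.update_of_ne hef] using hb
  simp only [Le3, bsig, MgS, decide_eq_true_eq]
  exact ⟨reach_mono h, reach_mono h, reach_mono h⟩

/-! ## The flip of one colour -/

/-- The flip of the colour of `f`. -/
def flipC (f : E₁) (ω : E₁ → Bool) : E₁ → Bool := Function.update ω f (!ω f)

/-- The flip is an involution. -/
theorem flipC_involutive (f : E₁) : Function.Involutive (flipC (E₁ := E₁) f) := by
  intro ω
  funext e
  by_cases he : e = f
  · subst he; simp [flipC]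
  · simp [flipC, Function.update_of_ne he]

/-- The flip as a permutation of the colourings. -/
def flipPerm (f : E₁) : Equiv.Perm (E₁ → Bool) := (flipC_involutive f).toPerm

/-- The flip at `f` evaluates to the negated colour at `f`. -/
theorem flipC_apply_self (f : E₁) (ω : E₁ → Bool) : flipC f ω f = !ω f := by
  simp [flipC]

/-! ## The symmetrised excess and its recursion -/

/-- The pointwise gap of the recursion at a free edge `f`. -/
noncomputable def gap (st : E₁ → EStat) (f : E₁) (ω : E₁ → Bool) : ℤ :=
  Fsym (rsig Z₁ u u' a₁ (Function.update st f .double) ω) (bsig Z₁ u u' a₁ (Function.update st f .absent) ω)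
    + Fsym (rsig Z₁ u u' a₁ (Function.update st f .absent) ω) (bsig Z₁ u u' a₁ (Function.update st f .double) ω)
    - Fsym (rsig Z₁ u u' a₁ (Function.update st f .absent) ω) (bsig Z₁ u u' a₁ (Function.update st f .absent) ω)
    - Fsym (rsig Z₁ u u' a₁ (Function.update st f .double) ω) (bsig Z₁ u u' a₁ (Function.update st f .double) ω)

/-- The gap is non-negative: THE KEY LEMMA at the patterns of the deletion and the contraction. -/
theorem gap_nonneg (st : E₁ → EStat) (f : E₁) (ω : E₁ → Bool) : 0 ≤ gap Z₁ u u' a₁ st f ω := by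
  have := key_lemma _ _ _ _ ⟨trans3_rsig Z₁ u u' a₁ (Function.update st f .absent) ω,
    trans3_rsig Z₁ u u' a₁ (Function.update st f .double) ω,
    trans3_bsig Z₁ u u' a₁ (Function.update st f .absent) ω,
    trans3_bsig Z₁ u u' a₁ (Function.update st f .double) ω,
    le3_rsig Z₁ u u' a₁ st f ω, le3_bsig Z₁ u u' a₁ st f ω⟩
  unfold gap
  linarith

/-- Colouring `f` red or blue: the two summands of the recursion. -/
theorem summand_add_flip (st : E₁ → EStat) (f : E₁) (hf : st f = .free) (ω : E₁ → Bool) :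
    Fsym (rsig Z₁ u u' a₁ st ω) (bsig Z₁ u u' a₁ st ω)
        + Fsym (rsig Z₁ u u' a₁ st (flipC f ω)) (bsig Z₁ u u' a₁ st (flipC f ω)) =
      Fsym (rsig Z₁ u u' a₁ (Function.update st f .double) ω) (bsig Z₁ u u' a₁ (Function.update st f .absent) ω)
        + Fsym (rsig Z₁ u u' a₁ (Function.update st f .absent) ω) (bsig Z₁ u u' a₁ (Function.update st f .double) ω) := by
  have hd : EStat.double ≠ EStat.free := by decide
  have ha : EStat.absent ≠ EStat.free := by decide
  by_cases hω : ω f = true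
  · have hω' : flipC f ω f = false := by simp [flipC_apply_self, hω]
    rw [rsig_of_true Z₁ u u' a₁ hf hω, bsig_of_true Z₁ u u' a₁ hf hω, rsig_of_false Z₁ u u' a₁ hf hω',
      bsig_of_false Z₁ u u' a₁ hf hω']
    unfold flipC
    rw [rsig_update_nonfree Z₁ u u' a₁ st f ha, bsig_update_nonfree Z₁ u u' a₁ st f hd]
  · have hω0 : ω f = false := by simpa using hω
    have hω' : flipC f ω f = true := by simp [flipC_apply_self, hω0]
    rw [rsig_of_false Z₁ u u' a₁ hf hω0, bsig_of_false Z₁ u u' a₁ hf hω0, rsig_of_true Z₁ u u' a₁ hf hω',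
      bsig_of_true Z₁ u u' a₁ hf hω']
    unfold flipC
    rw [rsig_update_nonfree Z₁ u u' a₁ st f hd, bsig_update_nonfree Z₁ u u' a₁ st f ha]
    exact add_comm _ _

variable [Fintype E₁]

open Classical in
/-- The symmetrised excess of a status: `Σ_ω Fsym (red pattern) (blue pattern)` over ALL colourings of `E₁`
(non-free edges ignore their colour). -/
noncomputable def esym (st : E₁ → EStat) : ℤ :=
  ∑ ω : E₁ → Bool, Fsym (rsig Z₁ u u' a₁ st ω) (bsig Z₁ u u' a₁ st ω)

/-- **THE RECURSION**: at a free edge `f`, twice the symmetrised excess is the excess of the deletion plus the excess of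
the contraction plus the (non-negative) gap. -/
theorem esym_rec (st : E₁ → EStat) (f : E₁) (hf : st f = .free) :
    2 * esym Z₁ u u' a₁ st = esym Z₁ u u' a₁ (Function.update st f .absent)
      + esym Z₁ u u' a₁ (Function.update st f .double) + ∑ ω : E₁ → Bool, gap Z₁ u u' a₁ st f ω := by
  have hflip : ∑ ω : E₁ → Bool, Fsym (rsig Z₁ u u' a₁ st ω) (bsig Z₁ u u' a₁ st ω) =
      ∑ ω : E₁ → Bool, Fsym (rsig Z₁ u u' a₁ st (flipC f ω)) (bsig Z₁ u u' a₁ st (flipC f ω)) :=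
    (Equiv.sum_comp (flipPerm f) (fun ω => Fsym (rsig Z₁ u u' a₁ st ω) (bsig Z₁ u u' a₁ st ω))).symm
  have h2 : 2 * esym Z₁ u u' a₁ st = ∑ ω : E₁ → Bool,
      (Fsym (rsig Z₁ u u' a₁ st ω) (bsig Z₁ u u' a₁ st ω)
        + Fsym (rsig Z₁ u u' a₁ st (flipC f ω)) (bsig Z₁ u u' a₁ st (flipC f ω))) := by
    rw [Finset.sum_add_distrib, ← hflip, esym]; ring
  rw [h2, esym, esym, ← Finset.sum_add_distrib, ← Finset.sum_add_distrib]
  refine Finset.sum_congr rfl fun ω _ => ?_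
  rw [summand_add_flip Z₁ u u' a₁ st f hf ω]
  unfold gap
  ring

/-! ## Induction on the number of free edges -/

omit [DecidableEq E₁] [Fintype E₁] in
/-- Without free edges the red and the blue patterns coincide. -/
theorem rsig_eq_bsig_of_nofree (st : E₁ → EStat) (hst : ∀ e, st e ≠ .free) (ω : E₁ → Bool) :
    rsig Z₁ u u' a₁ st ω = bsig Z₁ u u' a₁ st ω := by
  have h : RAdjS Z₁ st ω = BAdjS Z₁ st ω := by
    funext x y
    refine propext (exists_congr fun e => and_congr_right fun _ => ?_)
    simp [redE, blueE, hst e]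
  simp only [rsig, bsig, RdS, MgS, Prod.mk.injEq, decide_eq_decide, h, iff_self, and_self]

/-- Without free edges the symmetrised excess vanishes. -/
theorem esym_of_nofree (st : E₁ → EStat) (hst : ∀ e, st e ≠ .free) : esym Z₁ u u' a₁ st = 0 := by
  unfold esym
  refine Finset.sum_eq_zero fun ω _ => ?_
  rw [rsig_eq_bsig_of_nofree Z₁ u u' a₁ st hst ω, Fsym_self]

/-- The number of free edges. -/
noncomputable def nfree (st : E₁ → EStat) : ℕ := (univ.filter fun e => st e = .free).card

/-- Changing the status of a free edge to a non-free one lowers the free count by one. -/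
theorem nfree_update {st : E₁ → EStat} {f : E₁} (hf : st f = .free) {s : EStat} (hs : s ≠ .free) :
    nfree (Function.update st f s) + 1 = nfree st := by
  unfold nfree
  have h : (univ.filter fun e => Function.update st f s e = .free) = (univ.filter fun e => st e = .free).erase f := by
    ext e
    by_cases he : e = f
    · subst he; simp [hs]
    · simp [he]
  rw [h, Finset.card_erase_add_one]
  simp [hf]

/-- **THE SYMMETRISED EXCESS IS NON-NEGATIVE** for every status (induction on the number of free edges). -/
theorem esym_nonneg (st : E₁ → EStat) : 0 ≤ esym Z₁ u u' a₁ st := by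
  suffices h : ∀ n : ℕ, ∀ st : E₁ → EStat, nfree st = n → 0 ≤ esym Z₁ u u' a₁ st from h _ st rfl
  intro n
  induction n with
  | zero =>
    intro st hst
    have hno : ∀ e, st e ≠ .free := by
      intro e he
      have : e ∈ (univ.filter fun e => st e = .free) := by simp [he]
      rw [Finset.card_eq_zero.mp hst] at this
      exact absurd this (Finset.notMem_empty e)
    rw [esym_of_nofree Z₁ u u' a₁ st hno]
  | succ n ih =>
    intro st hst
    have hne : (univ.filter fun e => st e = .free).Nonempty := by
      rw [← Finset.card_pos]; unfold nfree at hst; omega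
    obtain ⟨f, hf⟩ := hne
    have hf' : st f = .free := (Finset.mem_filter.mp hf).2
    have ha := ih (Function.update st f .absent) (by
      have := nfree_update hf' (s := .absent) (by decide); omega)
    have hd := ih (Function.update st f .double) (by
      have := nfree_update hf' (s := .double) (by decide); omega)
    have hg : 0 ≤ ∑ ω : E₁ → Bool, gap Z₁ u u' a₁ st f ω :=
      Finset.sum_nonneg fun ω _ => gap_nonneg Z₁ u u' a₁ st f ω
    have := esym_rec Z₁ u u' a₁ st f hf'
    linarith

/-- **DELETION–CONTRACTION INEQUALITY**: the deletion and the contraction together have at most twice the excess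
(the normalisation `esym` counts every colouring of `E₁`, the colour of a non-free edge being irrelevant: at a free
edge `f` this is `e(G) ≥ e(G − f) + e(G/f)`). -/
theorem esym_absent_add_double_le (st : E₁ → EStat) (f : E₁) (hf : st f = .free) :
    esym Z₁ u u' a₁ (Function.update st f .absent) + esym Z₁ u u' a₁ (Function.update st f .double) ≤
      2 * esym Z₁ u u' a₁ st := by
  have hg : 0 ≤ ∑ ω : E₁ → Bool, gap Z₁ u u' a₁ st f ω :=
    Finset.sum_nonneg fun ω _ => gap_nonneg Z₁ u u' a₁ st f ω
  have := esym_rec Z₁ u u' a₁ st f hf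
  linarith

/-- **MONOTONICITY**: deleting a free edge does not raise the excess (`e(G − f) ≤ e(G)`). -/
theorem esym_absent_le (st : E₁ → EStat) (f : E₁) (hf : st f = .free) :
    esym Z₁ u u' a₁ (Function.update st f .absent) ≤ 2 * esym Z₁ u u' a₁ st := by
  have := esym_absent_add_double_le Z₁ u u' a₁ st f hf
  have := esym_nonneg Z₁ u u' a₁ (Function.update st f .double)
  linarith

/-- **MONOTONICITY**: contracting a free edge does not raise the excess (`e(G/f) ≤ e(G)`). -/
theorem esym_double_le (st : E₁ → EStat) (f : E₁) (hf : st f = .free) :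
    esym Z₁ u u' a₁ (Function.update st f .double) ≤ 2 * esym Z₁ u u' a₁ st := by
  have := esym_absent_add_double_le Z₁ u u' a₁ st f hf
  have := esym_nonneg Z₁ u u' a₁ (Function.update st f .absent)
  linarith

end MultiExit

end ZoneZ

end PercRepro
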